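import Mathlib.Topology.UniformSpace.UniformApproximation
import Mathlib.LinearAlgebra.Dual.Lemmas
import Mathlib.RepresentationTheory.Continuous.Basic
import Literature.NumberTheory.Automorphic.InfUnitaryHilbertCompletion
import Literature.NumberTheory.Automorphic.HilbertRepSpectrum
import Literature.NumberTheory.Automorphic.Liu2021.LemD2AsPrinted
import Literature.RepresentationTheory.GKModuleIrrClass
import HarnessLib

/-!
# The unitary, strongly continuous `K`-action on the Hilbert completion of an infinitesimally unitary `(𝔤, K)`-module

Topic `NumberTheory/Automorphic`; namespaces `Literature.NumberTheory.Automorphic.IsPosDefHerm` (§4) and `….InfUnitary` (§6); sequel of ★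
`InfUnitaryHilbertCompletion` (`E`, `emb`, `extend`).  Cell `hodgecm-mathlib`, F0∕P3, ROAD-GLOB
(`F0/P3/A-p14/ROAD-A6-UnitaryGlobalizationU21.A-p14g24.md`) to the letter A6 #92 `HasUnitaryGlobalizationOfInfUnitary` [KnappVogan1995, Thm. 0.6 (a)]
at `U(2,1)`: brick **G0**, second half.  Definitions WITH BODIES (`kRep`, `InfUnitary.form`) + their API, all proved; no named fact, no `instance`
declaration, no notation, no `sorry`.

THE MATHEMATICS ([KnappVogan1995, Introduction (0.5)–Thm. 0.6; BorelWallach2000, 0 §2.5]).  A group `K` acting on `(V, B)` by `B`-unitary operators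
(`B (k x) (k y) = B x y`) acts on the completion `E` by a UNITARY representation `kRep : ContRepresentation ℂ K E`, `kRep k (emb v) = emb (ρ k v)`
(each `ρ k` is `B`-isometric and surjective, ★ `IsPosDefHerm.extend_mem_unitary`; functoriality of ★ `extend`), which is STRONGLY CONTINUOUS as
soon as `ρ` is `K`-finite and weakly continuous (the `(𝔤, K)`-module axioms ★ `IsGKModule.kFinite`, `.weaklyContinuous`): on the dense subspace
`emb V` an orbit map moves in the finite-dimensional `K`-span of `v` with continuous coordinates (coordinate functionals extended to `V`, Mathlib
`Subspace.dualLift`), and isometries are equicontinuous (Mathlib `continuous_of_uniform_approx_of_continuous`).  §6 reads the CHOSEN form of ★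
`Liu2021.LemD2.IsInfUnitary` for `(𝔤, K)`-module data of `U(p,q) = uFormGroup α β` and records: positive definite Hermitian, `𝔤` skew, `K` unitary,
hence `kRep` unitary and — for a `(𝔤, K)`-module — strongly continuous.

HONEST LABEL: brick G0 of the road; closes no registered stub.  HC_CM is proved only modulo the 2 remaining named inputs (hLiu418, h413) until rung 0 closes.

## Mathlib ∕ tree search
Mathlib: `Representation`, `ContRepresentation.ofMonoidHom`, `Unitary`, `ContinuousLinearMap.norm_map_of_mem_unitary`, `Subspace.dualLift_of_mem`,
`Module.finBasis`, `continuous_of_uniform_approx_of_continuous`, `Metric.mem_uniformity_dist`.  Tree: ★ `InfUnitaryHilbertCompletion`, ★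
`ContRepresentation.IsUnitary`∕`.IsStronglyContinuous` (`HilbertRepSpectrum`), ★ `IsGKModule`, ★ `Liu2021.LemD2.IsInfUnitary`.  Dedup: `rg "kRep |InfUnitary.form"`
over `Literature/` — no hits.

## References
* A. W. Knapp, D. A. Vogan, *Cohomological Induction and Unitary Representations* (1995), Introduction (0.5), Thm. 0.6 [KnappVogan1995].
* A. Borel, N. Wallach, *Continuous Cohomology, Discrete Subgroups, and Representations of Reductive Groups*, 2nd ed. (2000), 0 §2.5 [BorelWallach2000].
-/

-- Mathlib idiom (Mathlib/Algebra/Lie/OfAssociative.lean; as in ★ `GKModules`): the commutator bracket on `Module.End ℂ W`, to MENTION `ρ𝔤` in §6.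
attribute [local instance 100] LieRing.ofAssociativeRing

set_option autoImplicit false

noncomputable section

open scoped InnerProductSpace ComplexConjugate
open Filter Topology

namespace Literature.NumberTheory.Automorphic

universe u

variable {V : Type u} [AddCommGroup V] [Module ℂ V]

namespace IsPosDefHerm

variable {B : V →ₗ⋆[ℂ] V →ₗ[ℂ] ℂ} (hB : IsPosDefHerm B)
include hB

/-! ## §4 The unitary action on `E` of a group of `B`-unitary operators -/

section KRep

variable {Kg : Type*} [Group Kg] (ρ : Representation ℂ Kg V) (hinv : ∀ (k : Kg) (x y : V), B (ρ k x) (ρ k y) = B x y)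
include hinv

/-- Each `ρ k` is `B`-isometric and surjective, hence `B`-bounded. [cite: BorelWallach2000, 0 §2.5] -/
theorem bound_rep (k : Kg) : ∃ C : ℝ, ∀ x, ‖hB.emb (ρ k x)‖ ≤ C * ‖hB.emb x‖ :=
  hB.bound_of_isometric (T := (ρ k : V →ₗ[ℂ] V)) (hinv k)

/-- **The unitary representation `kRep : ContRepresentation ℂ K E`** extending `ρ` along `emb` (each `kRep k := extend (ρ k)`).
[cite: KnappVogan1995, Introduction Thm. 0.6] [cite: BorelWallach2000, 0 §2.5] -/
def kRep : ContRepresentation ℂ Kg hB.E :=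
  ContRepresentation.ofMonoidHom
    { toFun := fun k => hB.extend (ρ k : V →ₗ[ℂ] V)
      map_one' := by
        change hB.extend (ρ 1 : V →ₗ[ℂ] V) = 1
        rw [map_one]
        exact hB.extend_id
      map_mul' := fun k k' => by
        change hB.extend (ρ (k * k') : V →ₗ[ℂ] V) = hB.extend (ρ k : V →ₗ[ℂ] V) * hB.extend (ρ k' : V →ₗ[ℂ] V)
        rw [map_mul, Module.End.mul_eq_comp, ContinuousLinearMap.mul_def]
        exact hB.extend_comp (hB.bound_rep ρ hinv k) (hB.bound_rep ρ hinv k') }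

/-- Unfolding: `kRep k = extend (ρ k)`. [cite: BorelWallach2000, 0 §2.5] -/
theorem kRep_apply (k : Kg) : hB.kRep ρ hinv k = hB.extend (ρ k : V →ₗ[ℂ] V) := rfl

/-- **`kRep k (emb v) = emb (ρ k v)`** — `emb` intertwines `ρ` and `kRep`. [cite: BorelWallach2000, 0 §2.5] -/
theorem kRep_emb (k : Kg) (v : V) : hB.kRep ρ hinv k (hB.emb v) = hB.emb (ρ k v) := by
  rw [hB.kRep_apply, hB.extend_emb (hB.bound_rep ρ hinv k)]

/-- Each `kRep k` is a unitary operator. [cite: KnappVogan1995, Introduction Thm. 0.6] -/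
theorem kRep_mem_unitary (k : Kg) : hB.kRep ρ hinv k ∈ unitary (hB.E →L[ℂ] hB.E) := by
  rw [hB.kRep_apply]
  refine hB.extend_mem_unitary (hinv k) fun x => ⟨ρ k⁻¹ x, ?_⟩
  change (ρ k * ρ k⁻¹) x = x
  rw [← map_mul, mul_inv_cancel, map_one, Module.End.one_apply]

/-- **`kRep` is a unitary representation** (★ `ContRepresentation.IsUnitary`). [cite: KnappVogan1995, Introduction Thm. 0.6] -/
theorem isUnitary_kRep : (hB.kRep ρ hinv).IsUnitary := fun k => hB.kRep_mem_unitary ρ hinv k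

/-- `‖kRep k z‖ = ‖z‖`. [cite: KnappVogan1995, Introduction Thm. 0.6] -/
theorem norm_kRep (k : Kg) (z : hB.E) : ‖hB.kRep ρ hinv k z‖ = ‖z‖ :=
  ContinuousLinearMap.norm_map_of_mem_unitary (hB.kRep_mem_unitary ρ hinv k) z

/-- `⟪kRep k z, kRep k z'⟫ = ⟪z, z'⟫`. [cite: KnappVogan1995, Introduction Thm. 0.6] -/
theorem inner_kRep_kRep (k : Kg) (z z' : hB.E) : ⟪hB.kRep ρ hinv k z, hB.kRep ρ hinv k z'⟫_ℂ = ⟪z, z'⟫_ℂ :=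
  ContinuousLinearMap.inner_map_map_of_mem_unitary (hB.kRep_mem_unitary ρ hinv k) z z'

omit hinv in
/-- **Orbit maps of a `K`-finite weakly continuous action are continuous after `emb`**: if the `K`-orbit of `v` spans a finite-dimensional
subspace and all matrix coefficients `k ↦ ℓ (ρ k v)` are continuous (★ `IsGKModule.kFinite`∕`.weaklyContinuous`), then `k ↦ emb (ρ k v)` is
continuous — write `ρ k v` in a basis of the span with coordinate functionals extended to `V` (Mathlib `Subspace.dualLift`).
[cite: BorelWallach2000, 0 §2.5] -/
theorem continuous_emb_orbit [TopologicalSpace Kg] (v : V)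
    (hfin : FiniteDimensional ℂ (Submodule.span ℂ (Set.range fun k : Kg => ρ k v)))
    (hwc : ∀ (ℓ : Module.Dual ℂ V), Continuous fun k : Kg => ℓ (ρ k v)) :
    Continuous fun k : Kg => hB.emb (ρ k v) := by
  set W : Submodule ℂ V := Submodule.span ℂ (Set.range fun k : Kg => ρ k v) with hW
  haveI := hfin
  have hmem : ∀ k, ρ k v ∈ W := fun k => Submodule.subset_span ⟨k, rfl⟩
  let b := Module.finBasis ℂ W
  -- coordinates `c i k := (b.coord i, extended to V) (ρ k v)` are continuous
  let ℓ : Fin (Module.finrank ℂ W) → Module.Dual ℂ V := fun i => Subspace.dualLift W (b.coord i)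
  have hℓ : ∀ i k, ℓ i (ρ k v) = b.repr ⟨ρ k v, hmem k⟩ i := fun i k => by
    simp only [ℓ]
    rw [Subspace.dualLift_of_mem (hmem k), Module.Basis.coord_apply]
  have hsum : ∀ k, ρ k v = ∑ i, ℓ i (ρ k v) • (b i : V) := fun k => by
    have h := b.sum_repr ⟨ρ k v, hmem k⟩
    have h' := congrArg (Submodule.subtype W) h
    simp only [map_sum, map_smul, Submodule.coe_subtype] at h'
    simp only [hℓ]
    exact h'.symm
  have key : ∀ k, hB.emb (ρ k v) = ∑ i, ℓ i (ρ k v) • hB.emb (b i : V) := fun k => by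
    conv_lhs => rw [hsum k]
    simp only [map_sum, map_smul]
  have : (fun k : Kg => hB.emb (ρ k v)) = fun k => ∑ i, ℓ i (ρ k v) • hB.emb (b i : V) := funext key
  rw [this]
  exact continuous_finsetSum _ fun i _ => (hwc (ℓ i)).smul continuous_const

/-- **`kRep` is strongly continuous** when `ρ` is `K`-finite and weakly continuous (★ `ContRepresentation.IsStronglyContinuous`): orbit maps
of `emb v` are continuous, `emb V` is dense, and the `kRep k` are isometries (uniform approximation). [cite: KnappVogan1995, Introduction Thm. 0.6]
[cite: BorelWallach2000, 0 §2.5] -/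
theorem isStronglyContinuous_kRep [TopologicalSpace Kg]
    (hfin : ∀ v : V, FiniteDimensional ℂ (Submodule.span ℂ (Set.range fun k : Kg => ρ k v)))
    (hwc : ∀ (v : V) (ℓ : Module.Dual ℂ V), Continuous fun k : Kg => ℓ (ρ k v)) :
    (hB.kRep ρ hinv).IsStronglyContinuous := by
  intro z
  refine continuous_of_uniform_approx_of_continuous fun u hu => ?_
  obtain ⟨ε, hε, hεu⟩ := Metric.mem_uniformity_dist.mp hu
  -- approximate `z` by `emb v`
  obtain ⟨_, ⟨v, rfl⟩, hv⟩ : ∃ y ∈ Set.range hB.emb, dist z y < ε :=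
    Metric.mem_closure_iff.mp (hB.denseRange_emb.closure_eq ▸ Set.mem_univ z) ε hε
  refine ⟨fun k => hB.emb (ρ k v), ?_, fun k => hεu ?_⟩
  · exact hB.continuous_emb_orbit ρ v (hfin v) (hwc v)
  · show dist (hB.kRep ρ hinv k z) (hB.emb (ρ k v)) < ε
    rw [← hB.kRep_emb ρ hinv k v, dist_eq_norm, ← map_sub, hB.norm_kRep ρ hinv, ← dist_eq_norm]
    exact hv

end KRep

end IsPosDefHerm

/-! ## §6 The form of an infinitesimally unitary `(𝔤, K)`-module of `U(p,q)` -/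

namespace InfUnitary

open Literature.RepresentationTheory Literature.RepresentationTheory.KonnoKonno2007
  Literature.RepresentationTheory.KonnoKonno2007.RealDualPair

variable {α β : Type} [Fintype α] [DecidableEq α] [Fintype β] [DecidableEq β]
variable {W : Type*} [AddCommGroup W] [Module ℂ W]
  {ρK : Representation ℂ (uFormGroup α β).maximalCompact W} {ρ𝔤 : (uFormGroup α β).lie →ₗ⁅ℝ⁆ Module.End ℂ W}

/-- **The CHOSEN form of an infinitesimally unitary `(𝔤, K)`-module** (★ `Liu2021.LemD2.IsInfUnitary` is an `∃`; `Classical.choose`).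
[cite: BorelWallach2000, 0 §2.5] -/
def form (hu : Liu2021.LemD2.IsInfUnitary ρK ρ𝔤) : W →ₗ⋆[ℂ] W →ₗ[ℂ] ℂ := hu.choose

/-- The chosen form is positive definite Hermitian. [cite: BorelWallach2000, 0 §2.5] -/
theorem isPosDefHerm_form (hu : Liu2021.LemD2.IsInfUnitary ρK ρ𝔤) : IsPosDefHerm (form hu) :=
  ⟨hu.choose_spec.1, hu.choose_spec.2.1⟩

/-- `𝔤` acts by skew operators for the chosen form. [cite: BorelWallach2000, 0 §2.5] -/
theorem form_skew (hu : Liu2021.LemD2.IsInfUnitary ρK ρ𝔤) (Y : (uFormGroup α β).lie) (x y : W) :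
    form hu (ρ𝔤 Y x) y = -form hu x (ρ𝔤 Y y) :=
  hu.choose_spec.2.2.1 Y x y

/-- `K` acts by unitary operators for the chosen form. [cite: BorelWallach2000, 0 §2.5] -/
theorem form_inv (hu : Liu2021.LemD2.IsInfUnitary ρK ρ𝔤) (k : (uFormGroup α β).maximalCompact) (x y : W) :
    form hu (ρK k x) (ρK k y) = form hu x y :=
  hu.choose_spec.2.2.2 k x y

/-- **The unitary `K`-representation on the completion of an infinitesimally unitary `(𝔤, K)`-module of `U(p,q)` is strongly continuous**
(★ `IsGKModule.kFinite` + `.weaklyContinuous`). [cite: KnappVogan1995, Introduction Thm. 0.6] -/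
theorem isStronglyContinuous_kRep_of_isGKModule (hu : Liu2021.LemD2.IsInfUnitary ρK ρ𝔤) (hV : IsGKModule (uFormGroup α β) ρK ρ𝔤) :
    ((isPosDefHerm_form hu).kRep ρK (form_inv hu)).IsStronglyContinuous :=
  (isPosDefHerm_form hu).isStronglyContinuous_kRep ρK (form_inv hu) hV.kFinite hV.weaklyContinuous

/-- And unitary. [cite: KnappVogan1995, Introduction Thm. 0.6] -/
theorem isUnitary_kRep (hu : Liu2021.LemD2.IsInfUnitary ρK ρ𝔤) :
    ((isPosDefHerm_form hu).kRep ρK (form_inv hu)).IsUnitary :=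
  (isPosDefHerm_form hu).isUnitary_kRep ρK (form_inv hu)

/-- `𝔤` is skew after `emb`: `⟪emb (ρ𝔤 Y x), emb y⟫ = −⟪emb x, emb (ρ𝔤 Y y)⟫`. [cite: BorelWallach2000, 0 §2.5] -/
theorem inner_emb_lie_eq_neg (hu : Liu2021.LemD2.IsInfUnitary ρK ρ𝔤) (Y : (uFormGroup α β).lie) (x y : W) :
    ⟪(isPosDefHerm_form hu).emb (ρ𝔤 Y x), (isPosDefHerm_form hu).emb y⟫_ℂ =
      -⟪(isPosDefHerm_form hu).emb x, (isPosDefHerm_form hu).emb (ρ𝔤 Y y)⟫_ℂ :=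
  (isPosDefHerm_form hu).inner_emb_map_eq_neg (X := (ρ𝔤 Y : W →ₗ[ℂ] W)) (form_skew hu Y) x y

end InfUnitary

end Literature.NumberTheory.Automorphic

end
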